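import Summits.QuantumFields.YangMills.Theorems.UnitScaleTiltHalvingStepOfPillarsCEPairLocalExists
import Summits.QuantumFields.YangMills.Theorems.UnitScaleTiltProp8HalvingDressedStationaritySU2
import Summits.QuantumFields.YangMills.Theorems.UnitScaleTiltHalvingCompetitorMapFibreStat
import Summits.QuantumFields.YangMills.Theorems.UnitScaleTiltProp8ChartDiff
import HarnessLib

/-!
# Route `UnitScaleTilt`, crux K1 «MinimiserStabilityRegPr» (stmt-QuantumFields-19200), stub V2′ `stub_halvingStep` — (K-E2E) door v3 (Stat currency), C_E end, lemma L2‴ =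
# THE STAT TWIN OF ✓L2″ `hpair_of_hcrit_local_exists`: **HYPOTHESIS (i) OF THE (165)-A₁ ROW FROM STATIONARITY OF THE WILSON ACTION ALONG DIFFERENTIABLE EXACT-FIBRE CURVES
# THROUGH THE MEMBER, THROUGH THE LOCALISED COMPETITOR MAP AND A DIFFERENTIABLE GAUGE FIX** (LEAD ★w5-19200 g4 RULING L-7 (a)∕(b): `RoomHalvingTextStat`, B5, FILE A twin)

Cell `ym3-torus` (HUMAN RULING D-0037: rung R3, not Clay), width seat `ym-ust-19200-w7` gen 1.  `--supports stmt-QuantumFields-19200 --as helper`; def-free, 0 sorry.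

WHY.  Door v2 (✓`HalvingStepOfPillarsRoomDoor.halvingStep_of_rows_room`) displays `IsMinOn 𝒲 (regFibrePr … ε₀ V) U` to its C_E binder, and the C_E cone consumes it at ONE
place: ✓L2″ :247–:256 turns it (with the `∃`-gauge fibre binder (Φ-1′) and regularity) into `IsMinOn (𝒲 ∘ Φloc) T₂ A`, read by ✓FILE A `tracePairing_of_isMinOn_localChart`
through Fermat along lines.  The H-SMALL route (b7) (★★OWNER RULING №30 (4)) needs the door in a FIRST-ORDER currency that lifts to covers: door v3 displays instead
`Stat(U)` — `deriv (t ↦ 𝒲(γ t)) 0 = 0` for every bondwise-differentiable curve `γ` in the EXACT fibre with `γ 0 = U` (L-7 (a), ✓`Prop7StubEXOfChartPiecesTwSL` :179–182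
letters).  This file is the corresponding L2: `hcrit`∕`hΦ1`∕`hε0`∕`hUcont` are GONE; displayed instead are `hstat` (= `Stat(Umin)`) and `hgauge` — on every competitor LINE
`t ↦ X_t = A + t·(s•Et)` in a `T`-direction (`Q s = 0`, `Et ∈ 𝔰𝔲(2)`) an `SU(2)` gauge family `h_t`, differentiable at `0` sitewise, with `h_t • Φloc X_t ∈ 𝔅_k(V)` for `|t| < r`
(row B5 «differentiable gauge fix», ★w1-19200 g8's files A–C, read on lines).  Then ★w1 g8's ✓`HalvingCompetitorMapFibreStat.deriv_wilsonAction_line_eq_zero_of_stat` gives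
`deriv (t ↦ 𝒲 (Φloc X_t)) 0 = 0` — the competitor line is bondwise differentiable because on charted bonds it reads `exp((Iη)•(X_t − H(D X_t)) b)` near `0` (the dressed
competitor is 𝔰𝔲(2)-valued on the ball ∩ `T`, ✓`dressed_competitor_su2`; `D` differentiable at `A`) and is constant elsewhere — and p06 g3's FILE A twin
✓`HalvingDressedStationaritySU2.tracePairing_of_derivZero_localChart` (with `S₀ :=` the `r₁`-ball; no regularity cut is needed any more) yields L2′'s `hpair` VERBATIM.

WHAT THIS FILE PROVES (no definition, no sorry):
* ★★ **`hpair_of_stat_local_exists`** — ✓L2″'s binder list with `hUcont`, `hε0`, `hcrit`, `hΦ1` deleted and `hstat`, `hgauge` added (after `hUmin` resp. `hchartNear`); conclusion =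
  L2′∕L2″'s `hpair` BYTE-IDENTICAL.  Pinning, level-0 dressing, `Φloc`, `hexp`∕`hoff` are ✓L2″ :216–:246 ∕ :289–:312 verbatim.
HONEST SCOPE: bookkeeping over landed lemmas; `hstat` (door v3) and `hgauge` (row B5) are hypotheses; NOT a claim about the stub, the crux, the rung or the gap.

References: T. Bałaban, CMP **102** (1985) 277–309 [Balaban1985Variational] (3)–(6) p.278, (44)–(49) p.285, (99) p.293, (111) p.294, (150) p.301, (157)–(158) p.302;
CMP **96** (1984) 223–250 [Balaban1984PropagatorsII] (2.3)–(2.4) p.224.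
-/

set_option autoImplicit false

noncomputable section

open scoped BigOperators Matrix Matrix.Norms.L2Operator Topology
open NormedSpace Filter

namespace Summit.QuantumFields.YangMills.Theorems.HalvingSitePackage

open Literature.MathematicalPhysics.QuantumFieldTheory.Balaban1983to89
open Literature.MathematicalPhysics.QuantumFieldTheory.Balaban1983to89.T3ContinuumYM3Torus
open Literature.MathematicalPhysics.QuantumFieldTheory.Balaban1983to89.T3PrintedRegularMinimiser
open B6SectADomainsV1 (Domains)
open B6SectAOperatorsV1 (BondIdx QE)
open LatticeFieldCalculus (bondAvgIter)
open B5Eq120IterProof (bondAvgIter_zero)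
open FlatCubeOpsText (IsLevWeight)
open FlatOpsLettersAssembly (flatH levWeight_nonneg)
open Prop8ChartDoubleBar (chartLogFlat chartLogFlat_apply fderiv_chartLogFlat_zero_apply dressed_competitor_su2 exists_lineRadius_of_mem_weightedBall)
open Literature.MathematicalPhysics.QuantumFieldTheory.Balaban1983to89.T3UnitLawDensityEML (ℰp)
open Literature.MathematicalPhysics.QuantumFieldTheory.Balaban1983to89.T3ConstrainedMinimiser (fibre)

/-! ## L2‴ -/

-- heartbeat budget (HOME README rule): > 60-line signature with two FILE-E-sized formula hypotheses; budgeted 400k on this declaration only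
set_option maxHeartbeats 400000 in
/-- **L2‴: (i) OF THE (165) ROW FROM `Stat(Umin)` THROUGH THE LOCALISED COMPETITOR MAP AND A DIFFERENTIABLE GAUGE FIX** — see the module docstring; `A` is the chart
preimage (L1's `A′`), `H` the level-scaled extension `Hs`, `D` the dressing map `Dsel` of FILE E, `Uc` an `SU(2)` chart of 𝔰𝔲(2)-valued fields, `Near`∕`Tch` the charted bonds ∕
the plaquettes touching the region, `uS` the gauge of the regional chart identity, `hstat` door v3's clause, `hgauge` row B5 on the `T`-direction lines.
[cite: Balaban1985Variational, (3)-(6) p.278, (47)-(49) p.285, (99) p.293, (111) p.294, (150) p.301, (157)-(158) p.302; Balaban1984PropagatorsII, (2.3)-(2.4) p.224] -/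
theorem hpair_of_stat_local_exists (F : T3Family) (n K : ℕ) (Dm : Domains (F.P K)) (hDk : Dm.k = K - n)
    (hcollar : ∀ (i : ℕ) (e : PBond (F.P K) (i + 1)), Dm.LamBond (i + 1) e → ∀ z : Site (F.P K) i, (blockOf z = e.src ∨ blockOf z = e.tgt) → z ∈ Dm.Om i)
    {w : ℕ → PBond (F.P K) 0 → ℝ} (hw : IsLevWeight F n K Dm w)
    {R : ℝ} (hR : 16 * 3800 * ((((F.P K).d + 2) * (F.P K).L : ℕ) : ℝ) ^ 2 * (F.L : ℝ) * R ≤ 1)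
    (η : ℝ) (hη : η ≠ 0)
    (W₀ : (PBond (F.P K) 0 → Matrix (Fin 2) (Fin 2) ℂ) → (PBond (F.P K) 0 → Matrix (Fin 2) (Fin 2) ℂ)) (hSd : Differentiable ℂ (fun A : PBond (F.P K) 0 → Matrix (Fin 2) (Fin 2) ℂ => (∑ p : Plaq (F.P K) 0, (1 - (2 : ℂ)⁻¹ * Matrix.trace (exp ((Complex.I * (η : ℂ)) • A ⟨p.src, p.μ⟩) * exp ((Complex.I * (η : ℂ)) • A ⟨p.src.shift p.μ, p.ν⟩) * exp (-((Complex.I * (η : ℂ)) • A ⟨p.src.shift p.ν, p.μ⟩)) * exp (-((Complex.I * (η : ℂ)) • A ⟨p.src, p.ν⟩)))))))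
    (hgrad : ∀ A δ : PBond (F.P K) 0 → Matrix (Fin 2) (Fin 2) ℂ, fderiv ℂ (fun A : PBond (F.P K) 0 → Matrix (Fin 2) (Fin 2) ℂ => (∑ p : Plaq (F.P K) 0, (1 - (2 : ℂ)⁻¹ * Matrix.trace (exp ((Complex.I * (η : ℂ)) • A ⟨p.src, p.μ⟩) * exp ((Complex.I * (η : ℂ)) • A ⟨p.src.shift p.μ, p.ν⟩) * exp (-((Complex.I * (η : ℂ)) • A ⟨p.src.shift p.ν, p.μ⟩)) * exp (-((Complex.I * (η : ℂ)) • A ⟨p.src, p.ν⟩)))))) A δ =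
      ((η : ℂ) ^ 2 / 2) * ∑ p : Plaq (F.P K) 0, Matrix.trace ((A ⟨p.src, p.μ⟩ + A ⟨p.src.shift p.μ, p.ν⟩ - A ⟨p.src.shift p.ν, p.μ⟩ - A ⟨p.src, p.ν⟩) * (δ ⟨p.src, p.μ⟩ + δ ⟨p.src.shift p.μ, p.ν⟩ - δ ⟨p.src.shift p.ν, p.μ⟩ - δ ⟨p.src, p.ν⟩)) + (η : ℂ) ^ 4 * ∑ b : PBond (F.P K) 0, Matrix.trace (W₀ A b * δ b))
    (H : (BondIdx Dm → Matrix (Fin 2) (Fin 2) ℂ) →ₗ[ℂ] (PBond (F.P K) 0 → Matrix (Fin 2) (Fin 2) ℂ))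
    (hHs : ∀ X b, H X b = ∑ c, (flatH F n K Dm (Pi.single c 1) b * ((F.L : ℝ) ^ (c.1.1 : ℕ) * ((F.L : ℝ)⁻¹) ^ (K - n))⁻¹) • X c)
    (D : (PBond (F.P K) 0 → Matrix (Fin 2) (Fin 2) ℂ) → (BondIdx Dm → Matrix (Fin 2) (Fin 2) ℂ))
    (E : (PBond (F.P K) 0 → Matrix (Fin 2) (Fin 2) ℂ) → (PBond (F.P K) 0 → Matrix (Fin 2) (Fin 2) ℂ))
    (hE : ∀ (Y : PBond (F.P K) 0 → Matrix (Fin 2) (Fin 2) ℂ) (b : PBond (F.P K) 0) (i j : Fin 2), E Y b i j = ((η : ℂ) ^ 4)⁻¹ *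
      (-(((η : ℂ) ^ 2 / 2) * ∑ p : Plaq (F.P K) 0, Matrix.trace ((H (D Y) ⟨p.src, p.μ⟩ + H (D Y) ⟨p.src.shift p.μ, p.ν⟩ - H (D Y) ⟨p.src.shift p.ν, p.μ⟩ - H (D Y) ⟨p.src, p.ν⟩) *
          ((Pi.single b (Matrix.single j i (1 : ℂ)) : PBond (F.P K) 0 → Matrix (Fin 2) (Fin 2) ℂ) ⟨p.src, p.μ⟩ + (Pi.single b (Matrix.single j i (1 : ℂ)) : PBond (F.P K) 0 → Matrix (Fin 2) (Fin 2) ℂ) ⟨p.src.shift p.μ, p.ν⟩ -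
            (Pi.single b (Matrix.single j i (1 : ℂ)) : PBond (F.P K) 0 → Matrix (Fin 2) (Fin 2) ℂ) ⟨p.src.shift p.ν, p.μ⟩ - (Pi.single b (Matrix.single j i (1 : ℂ)) : PBond (F.P K) 0 → Matrix (Fin 2) (Fin 2) ℂ) ⟨p.src, p.ν⟩)))
        - ((η : ℂ) ^ 2 / 2) * ∑ p : Plaq (F.P K) 0, Matrix.trace (((Y - H (D Y)) ⟨p.src, p.μ⟩ + (Y - H (D Y)) ⟨p.src.shift p.μ, p.ν⟩ - (Y - H (D Y)) ⟨p.src.shift p.ν, p.μ⟩ - (Y - H (D Y)) ⟨p.src, p.ν⟩) *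
          (H (fderiv ℂ D Y (Pi.single b (Matrix.single j i (1 : ℂ)))) ⟨p.src, p.μ⟩ + H (fderiv ℂ D Y (Pi.single b (Matrix.single j i (1 : ℂ)))) ⟨p.src.shift p.μ, p.ν⟩ -
            H (fderiv ℂ D Y (Pi.single b (Matrix.single j i (1 : ℂ)))) ⟨p.src.shift p.ν, p.μ⟩ - H (fderiv ℂ D Y (Pi.single b (Matrix.single j i (1 : ℂ)))) ⟨p.src, p.ν⟩))
        - (η : ℂ) ^ 4 * ∑ b' : PBond (F.P K) 0, Matrix.trace (W₀ (Y - H (D Y)) b' * H (fderiv ℂ D Y (Pi.single b (Matrix.single j i (1 : ℂ)))) b')))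
    {r₁ t : ℝ}
    (h49 : ∀ X : PBond (F.P K) 0 → Matrix (Fin 2) (Fin 2) ℂ, (∀ b, w 1 b * ‖X b‖ < r₁) → (fun (Z : PBond (F.P K) 0 → Matrix (Fin 2) (Fin 2) ℂ) => chartLogFlat ((((F.L : ℝ))⁻¹) ^ (K - n)) Dm Z - (fderiv ℂ (chartLogFlat ((((F.L : ℝ))⁻¹) ^ (K - n)) Dm : (PBond (F.P K) 0 → Matrix (Fin 2) (Fin 2) ℂ) → BondIdx Dm → Matrix (Fin 2) (Fin 2) ℂ) 0) Z) (X - H (D X)) = D X)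
    (hsize : ∀ X : PBond (F.P K) 0 → Matrix (Fin 2) (Fin 2) ℂ, (∀ b, w 1 b * ‖X b‖ < r₁) → ∀ c, ‖D X c‖ ≤ t)
    (huniq : ∀ X : PBond (F.P K) 0 → Matrix (Fin 2) (Fin 2) ℂ, (∀ b, w 1 b * ‖X b‖ < r₁) → ∀ D' : BondIdx Dm → Matrix (Fin 2) (Fin 2) ℂ, (∀ c, ‖D' c‖ ≤ t) → (fun (Z : PBond (F.P K) 0 → Matrix (Fin 2) (Fin 2) ℂ) => chartLogFlat ((((F.L : ℝ))⁻¹) ^ (K - n)) Dm Z - (fderiv ℂ (chartLogFlat ((((F.L : ℝ))⁻¹) ^ (K - n)) Dm : (PBond (F.P K) 0 → Matrix (Fin 2) (Fin 2) ℂ) → BondIdx Dm → Matrix (Fin 2) (Fin 2) ℂ) 0) Z) (X - H D') = D' → D' = D X)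
    (hDd : ∀ X : PBond (F.P K) 0 → Matrix (Fin 2) (Fin 2) ℂ, (∀ b, w 1 b * ‖X b‖ < r₁) → DifferentiableAt ℂ D X)
    (hball : ∀ X : PBond (F.P K) 0 → Matrix (Fin 2) (Fin 2) ℂ, (∀ b, w 1 b * ‖X b‖ < r₁) → ∀ b, w 1 b * ‖(X - H (D X)) b‖ < R)
    (Uc : (PBond (F.P K) 0 → Matrix (Fin 2) (Fin 2) ℂ) → GaugeField (F.P K) 0 (Matrix.specialUnitaryGroup (Fin 2) ℂ))
    (hUc : ∀ Y : PBond (F.P K) 0 → Matrix (Fin 2) (Fin 2) ℂ, (∀ b, IsSelfAdjoint (Y b)) → (∀ b, Matrix.trace (Y b) = 0) →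
      ∀ b, ((Uc Y b : Matrix.specialUnitaryGroup (Fin 2) ℂ) : Matrix (Fin 2) (Fin 2) ℂ) = exp ((Complex.I * (η : ℂ)) • Y b))
    {A : PBond (F.P K) 0 → Matrix (Fin 2) (Fin 2) ℂ} (hAsa : ∀ b, IsSelfAdjoint (A b)) (hAtr : ∀ b, Matrix.trace (A b) = 0) (hAS : ∀ b, w 1 b * ‖A b‖ < r₁)
    (hnK : n ≤ K) (ε₀ : ℝ) (V : GaugeField (F.P n) 0 (Matrix.specialUnitaryGroup (Fin 2) ℂ)) {Umin : GaugeField (F.P K) 0 (Matrix.specialUnitaryGroup (Fin 2) ℂ)}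
    (hUmin : Umin ∈ regFibrePr F n K hnK ε₀ V)
    (hstat : ∀ γ : ℝ → GaugeField (F.P K) 0 (Matrix.specialUnitaryGroup (Fin 2) ℂ), γ 0 = Umin → (∀ t, γ t ∈ fibre F ℰp n K hnK V) →
      (∀ b, DifferentiableAt ℝ (fun t => ((γ t b : Matrix.specialUnitaryGroup (Fin 2) ℂ) : Matrix (Fin 2) (Fin 2) ℂ)) 0) →
      deriv (fun t => wilsonAction4 (γ t)) 0 = 0)
    (hHinv : ∀ Y : BondIdx Dm → Matrix (Fin 2) (Fin 2) ℂ, (fderiv ℂ (chartLogFlat ((((F.L : ℝ))⁻¹) ^ (K - n)) Dm : (PBond (F.P K) 0 → Matrix (Fin 2) (Fin 2) ℂ) → BondIdx Dm → Matrix (Fin 2) (Fin 2) ℂ) 0) (H Y) = Y)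
    (Near : PBond (F.P K) 0 → Prop) [DecidablePred Near] (Tch : Plaq (F.P K) 0 → Prop)
    (hTN : ∀ p : Plaq (F.P K) 0, Tch p → Near ⟨p.src, p.μ⟩ ∧ Near ⟨p.src.shift p.μ, p.ν⟩ ∧ Near ⟨p.src.shift p.ν, p.μ⟩ ∧ Near ⟨p.src, p.ν⟩)
    (hTF : ∀ p : Plaq (F.P K) 0, ¬ Tch p → Dm.LamBond 0 ⟨p.src, p.μ⟩ ∧ Dm.LamBond 0 ⟨p.src.shift p.μ, p.ν⟩ ∧ Dm.LamBond 0 ⟨p.src.shift p.ν, p.μ⟩ ∧ Dm.LamBond 0 ⟨p.src, p.ν⟩)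
    (uS : GaugeTransf (F.P K) 0 (Matrix.specialUnitaryGroup (Fin 2) ℂ))
    (hchartNear : ∀ b, Near b → ((GaugeField.gaugeAct uS Umin b : Matrix.specialUnitaryGroup (Fin 2) ℂ) : Matrix (Fin 2) (Fin 2) ℂ) = exp ((Complex.I * (η : ℂ)) • (A - H (D A)) b))
    (hgauge : ∀ s : PBond (F.P K) 0 → ℝ, QE Dm (WithLp.toLp 2 s) = 0 → ∀ Et : Matrix (Fin 2) (Fin 2) ℂ, IsSelfAdjoint Et → Matrix.trace Et = 0 →
      ∃ r : ℝ, 0 < r ∧ ∃ h : ℝ → GaugeTransf (F.P K) 0 (Matrix.specialUnitaryGroup (Fin 2) ℂ),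
        (∀ t : ℝ, |t| < r → GaugeField.gaugeAct (h t)
          (fun b => if Near b then Uc ((A + t • fun b => ((s b : ℝ) : ℂ) • Et) - H (D (A + t • fun b => ((s b : ℝ) : ℂ) • Et))) b else GaugeField.gaugeAct uS Umin b) ∈
            fibre F ℰp n K hnK V) ∧
        ∀ x, DifferentiableAt ℝ (fun t => ((h t x : Matrix.specialUnitaryGroup (Fin 2) ℂ) : Matrix (Fin 2) (Fin 2) ℂ)) 0) :
    ∀ s : PBond (F.P K) 0 → ℝ, QE Dm (WithLp.toLp 2 s) = 0 → ∀ Et : Matrix (Fin 2) (Fin 2) ℂ, IsSelfAdjoint Et → Matrix.trace Et = 0 →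
    (((η : ℂ) ^ 2 / 2) * ∑ p : Plaq (F.P K) 0, Matrix.trace ((A ⟨p.src, p.μ⟩ + A ⟨p.src.shift p.μ, p.ν⟩ - A ⟨p.src.shift p.ν, p.μ⟩ - A ⟨p.src, p.ν⟩) * (((s ⟨p.src, p.μ⟩ : ℝ) : ℂ) • Et + ((s ⟨p.src.shift p.μ, p.ν⟩ : ℝ) : ℂ) • Et - ((s ⟨p.src.shift p.ν, p.μ⟩ : ℝ) : ℂ) • Et - ((s ⟨p.src, p.ν⟩ : ℝ) : ℂ) • Et)) +
      (η : ℂ) ^ 4 * ∑ b : PBond (F.P K) 0, Matrix.trace ((W₀ (A - H (D A)) b + E A b) * (((s b : ℝ) : ℂ) • Et))).re = 0 := by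
  have hw1 : ∀ b, 0 ≤ w 1 b := fun b => levWeight_nonneg hw 1 b
  set k : PBond (F.P K) 0 → BondIdx Dm → ℝ := fun b c => flatH F n K Dm (Pi.single c 1) b * ((F.L : ℝ) ^ (c.1.1 : ℕ) * ((F.L : ℝ)⁻¹) ^ (K - n))⁻¹ with hk
  have hHs' : ∀ X b, H X b = ∑ c, k b c • X c := hHs
  -- the dressed competitors are 𝔰𝔲(2)-valued
  have hdress : ∀ X : PBond (F.P K) 0 → Matrix (Fin 2) (Fin 2) ℂ, (∀ b, IsSelfAdjoint (X b)) → (∀ b, Matrix.trace (X b) = 0) → (∀ b, w 1 b * ‖X b‖ < r₁) →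
      (∀ b, IsSelfAdjoint ((X - H (D X)) b)) ∧ ∀ b, Matrix.trace ((X - H (D X)) b) = 0 := fun X hXsa hXtr hXS =>
    dressed_competitor_su2 F n K Dm hDk hcollar hw hR H k hHs' hXsa hXtr (hball X hXS) (h49 X hXS) (hsize X hXS) (huniq X hXS)
  have hdA := hdress A hAsa hAtr hAS
  set T : Set (PBond (F.P K) 0 → Matrix (Fin 2) (Fin 2) ℂ) := {X : PBond (F.P K) 0 → Matrix (Fin 2) (Fin 2) ℂ | (∀ b, IsSelfAdjoint (X b)) ∧ (∀ b, Matrix.trace (X b) = 0) ∧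
      (∀ c : BondIdx Dm, bondAvgIter (c.1.1 : ℕ) X c.1.2 = bondAvgIter (c.1.1 : ℕ) A c.1.2) ∧ X ∈ {Y : PBond (F.P K) 0 → Matrix (Fin 2) (Fin 2) ℂ | ∀ b, w 1 b * ‖Y b‖ < r₁}} with hT
  -- (a) the weight floor `η♭ ≤ w₁(b)` and the window `R ≤ 1/5`
  have hL1 : (1 : ℝ) ≤ (F.L : ℝ) := by exact_mod_cast F.hL.2.le
  have hη0 : 0 ≤ ((F.L : ℝ))⁻¹ ^ (K - n) := pow_nonneg (inv_nonneg.2 (by positivity)) _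
  have hwfloor : ∀ b : PBond (F.P K) 0, ((F.L : ℝ))⁻¹ ^ (K - n) ≤ w 1 b := fun b => by
    rw [hw 1 b, pow_one]
    exact le_mul_of_one_le_left hη0 (one_le_pow₀ hL1)
  have hR5 : R ≤ 1 / 5 := by
    by_cases hR0 : R ≤ 0
    · linarith
    have hR0' : 0 < R := lt_of_not_ge hR0
    have hc : (1 : ℝ) ≤ ((((F.P K).d + 2) * (F.P K).L : ℕ) : ℝ) := by
      exact_mod_cast Nat.succ_le_of_lt (Nat.mul_pos (by omega) (F.P K).L_pos)
    have hc2 : (1 : ℝ) ≤ ((((F.P K).d + 2) * (F.P K).L : ℕ) : ℝ) ^ 2 * (F.L : ℝ) := one_le_mul_of_one_le_of_one_le (one_le_pow₀ hc) hL1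
    have h1 : 16 * 3800 * R ≤ 16 * 3800 * ((((F.P K).d + 2) * (F.P K).L : ℕ) : ℝ) ^ 2 * (F.L : ℝ) * R := by nlinarith
    linarith
  -- (b) PINNING: a level-0 index datum is the bond value, so every competitor equals `A` on `Λ₀`
  have hpin : ∀ X ∈ T, ∀ (b : PBond (F.P K) 0) (hb : Dm.LamBond 0 b), X b = A b := fun X hX b hb => by
    have h := hX.2.2.1 ⟨⟨⟨0, Nat.succ_pos _⟩, b⟩, hb⟩
    simpa only [bondAvgIter_zero] using h
  -- (c) THE LEVEL-0 DRESSING VANISHES on the ball ((49) at a level-0 index; `logTower_zero`)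
  have hD0 : ∀ Y : PBond (F.P K) 0 → Matrix (Fin 2) (Fin 2) ℂ, (∀ b, w 1 b * ‖Y b‖ < r₁) → ∀ (b : PBond (F.P K) 0) (hb : Dm.LamBond 0 b),
      D Y ⟨⟨⟨0, Nat.succ_pos _⟩, b⟩, hb⟩ = 0 := fun Y hY b hb => by
    have hsmall : ‖((((((F.L : ℝ))⁻¹ ^ (K - n) : ℝ)) : ℂ) • (Y - H (D Y))) b‖ ≤ 1 / 5 := by
      rw [Pi.smul_apply, norm_smul, Complex.norm_real, Real.norm_of_nonneg hη0]
      have h1 : ((F.L : ℝ))⁻¹ ^ (K - n) * ‖(Y - H (D Y)) b‖ ≤ w 1 b * ‖(Y - H (D Y)) b‖ := mul_le_mul_of_nonneg_right (hwfloor b) (norm_nonneg _)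
      linarith [hball Y hY b]
    have h := congr_fun (h49 Y hY) ⟨⟨⟨0, Nat.succ_pos _⟩, b⟩, hb⟩
    simp only [Pi.sub_apply] at h
    rw [fderiv_chartLogFlat_zero_apply, chartLogFlat_apply] at h
    have h' : (-Complex.I) • MatrixLog.mlog (((Prop8ChartDoubleBar.dbarIterU 0 (Prop8Chart.expCfg (((F.L : ℝ))⁻¹ ^ (K - n)) (Y - H (D Y)))) b :
        (Matrix (Fin 2) (Fin 2) ℂ)ˣ) : Matrix (Fin 2) (Fin 2) ℂ) -
        ((((((F.L : ℝ))⁻¹ ^ (K - n) : ℝ)) : ℂ) * (((F.P K).L : ℕ) : ℂ) ^ (0 : ℕ)) • bondAvgIter 0 (Y - H (D Y)) b = D Y ⟨⟨⟨0, Nat.succ_pos _⟩, b⟩, hb⟩ := h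
    rw [ChartKernelFlat.logTower_zero _ _ b hsmall, pow_zero, mul_one, bondAvgIter_zero, Pi.smul_apply, sub_self] at h'
    exact h'.symm
  -- `H` at a level-0 bond reads the level-0 datum (`hHinv` at level 0), so the dressing disappears from the dressed competitor on `Λ₀`
  have hHD0 : ∀ Y : PBond (F.P K) 0 → Matrix (Fin 2) (Fin 2) ℂ, (∀ b, w 1 b * ‖Y b‖ < r₁) → ∀ (b : PBond (F.P K) 0), Dm.LamBond 0 b → H (D Y) b = 0 :=
      fun Y hY b hb => by
    have h := congr_fun (hHinv (D Y)) ⟨⟨⟨0, Nat.succ_pos _⟩, b⟩, hb⟩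
    rw [fderiv_chartLogFlat_zero_apply] at h
    have h' : ((((((F.L : ℝ))⁻¹ ^ (K - n) : ℝ)) : ℂ) * (((F.P K).L : ℕ) : ℂ) ^ (0 : ℕ)) • bondAvgIter 0 (H (D Y)) b = D Y ⟨⟨⟨0, Nat.succ_pos _⟩, b⟩, hb⟩ := h
    rw [pow_zero, mul_one, bondAvgIter_zero, hD0 Y hY b hb, smul_eq_zero] at h'
    have hLpos : (0 : ℝ) < (F.L : ℝ) := by linarith
    have hηne : ((((F.L : ℝ))⁻¹ ^ (K - n) : ℝ) : ℂ) ≠ 0 := by exact_mod_cast (pow_pos (inv_pos.2 hLpos) (K - n)).ne'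
    exact h'.resolve_left hηne
  have hZ : ∀ X ∈ T, ∀ (b : PBond (F.P K) 0), Dm.LamBond 0 b → (X - H (D X)) b = (A - H (D A)) b := fun X hX b hb => by
    rw [Pi.sub_apply, Pi.sub_apply, hHD0 X hX.2.2.2 b hb, hHD0 A hAS b hb, hpin X hX b hb]
  -- (d) the local competitor map
  obtain ⟨Φloc, hΦloc⟩ : ∃ Φ : (PBond (F.P K) 0 → Matrix (Fin 2) (Fin 2) ℂ) → GaugeField (F.P K) 0 (Matrix.specialUnitaryGroup (Fin 2) ℂ),
      ∀ X b, Φ X b = if Near b then Uc (X - H (D X)) b else GaugeField.gaugeAct uS Umin b := ⟨fun X b => if Near b then Uc (X - H (D X)) b else GaugeField.gaugeAct uS Umin b, fun _ _ => rfl⟩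
  have hΦfun : ∀ X, Φloc X = fun b => if Near b then Uc (X - H (D X)) b else GaugeField.gaugeAct uS Umin b := fun X => funext (hΦloc X)
  -- the chart point hits the minimiser's gauge copy (REGIONAL chart identity on the Near bonds, the copy itself elsewhere)
  have hΦA : Φloc A = GaugeField.gaugeAct uS Umin := by
    funext b
    rw [hΦloc]
    by_cases hNb : Near b
    · rw [if_pos hNb]
      exact Subtype.ext (by rw [hUc _ hdA.1 hdA.2 b, hchartNear b hNb])
    · rw [if_neg hNb]
  -- the ball is open along lines at `A`
  have hSopen : ∀ δ : PBond (F.P K) 0 → Matrix (Fin 2) (Fin 2) ℂ, ∃ r : ℝ, 0 < r ∧ ∀ t : ℝ, |t| < r →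
      A + t • δ ∈ {Y : PBond (F.P K) 0 → Matrix (Fin 2) (Fin 2) ℂ | ∀ b, w 1 b * ‖Y b‖ < r₁} := fun δ => by
    obtain ⟨r, hr, h⟩ := exists_lineRadius_of_mem_weightedBall (w 1) hw1 hAS δ
    exact ⟨r, hr, fun t ht => h t ht⟩
  -- STATIONARITY ALONG THE COMPETITOR LINES from `hstat` (door v3's clause at the member) through the differentiable gauge fix `hgauge` (★w1-19200 g8's glue)
  have hUfib : Umin ∈ fibre F ℰp n K hnK V := ((mem_regFibrePr_iff F).1 hUmin).1
  have hderiv : ∀ s : PBond (F.P K) 0 → ℝ, QE Dm (WithLp.toLp 2 s) = 0 → ∀ Et : Matrix (Fin 2) (Fin 2) ℂ, IsSelfAdjoint Et → Matrix.trace Et = 0 →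
      deriv (fun t : ℝ => wilsonAction4 (Φloc (A + t • fun b => ((s b : ℝ) : ℂ) • Et))) 0 = 0 := by
    intro s hs Et hEt hEttr
    set δ : PBond (F.P K) 0 → Matrix (Fin 2) (Fin 2) ℂ := fun b => ((s b : ℝ) : ℂ) • Et with hδ
    obtain ⟨r, hr, h, hfib, hhd⟩ := hgauge s hs Et hEt hEttr
    -- the line stays in the ball, hence in `T`, near `t = 0`
    obtain ⟨r', hr', hball'⟩ := hSopen δ
    have hT' : ∀ t : ℝ, |t| < r' → A + t • δ ∈ T := fun t ht =>
      HalvingDressedStationaritySU2.segment_mem_competitorSet Dm (S₀ := {Y : PBond (F.P K) 0 → Matrix (Fin 2) (Fin 2) ℂ | ∀ b, w 1 b * ‖Y b‖ < r₁})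
        (Bdat := fun c => bondAvgIter (c.1.1 : ℕ) A c.1.2) hAsa hAtr (fun c => rfl) hs hEt hEttr hball' t ht
    -- bondwise differentiability of the competitor line at `0`
    have hWd : ∀ b, DifferentiableAt ℝ (fun t : ℝ => ((Φloc (A + t • δ) b : Matrix.specialUnitaryGroup (Fin 2) ℂ) : Matrix (Fin 2) (Fin 2) ℂ)) 0 := by
      intro b
      by_cases hNb : Near b
      · -- on a charted bond the line reads `exp ((Iη) • (X_t − H (D X_t)) b)` for `|t| < r′`
        have hev : (fun t : ℝ => ((Φloc (A + t • δ) b : Matrix.specialUnitaryGroup (Fin 2) ℂ) : Matrix (Fin 2) (Fin 2) ℂ)) =ᶠ[nhds 0]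
            fun t : ℝ => ((Prop8Chart.expCfg η ((A + t • δ) - H (D (A + t • δ))) b : (Matrix (Fin 2) (Fin 2) ℂ)ˣ) : Matrix (Fin 2) (Fin 2) ℂ) := by
          filter_upwards [Ioo_mem_nhds (show -r' < 0 by linarith) hr'] with t ht
          have htabs : |t| < r' := abs_lt.2 ⟨ht.1, ht.2⟩
          have hd := hdress (A + t • δ) (hT' t htabs).1 (hT' t htabs).2.1 (hT' t htabs).2.2.2
          rw [hΦloc, if_pos hNb, Prop8Chart.coe_expCfg]
          exact hUc _ hd.1 hd.2 b
        refine (hev.differentiableAt_iff).2 ?_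
        -- `X ↦ exp ((Iη) • (X − H (D X)) b)` is ℂ-differentiable at `A`; compose with the real line
        have hline : DifferentiableAt ℝ (fun t : ℝ => A + t • δ) 0 := (differentiableAt_const _).add (differentiableAt_id.smul_const δ)
        have hHl : Differentiable ℂ fun Y : BondIdx Dm → Matrix (Fin 2) (Fin 2) ℂ => H Y := (LinearMap.toContinuousLinearMap H).differentiable
        have hΨ : DifferentiableAt ℂ (fun X : PBond (F.P K) 0 → Matrix (Fin 2) (Fin 2) ℂ => X - H (D X)) (A + (0 : ℝ) • δ) := by
          rw [zero_smul, add_zero]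
          exact differentiableAt_id.sub ((hHl.differentiableAt).comp A (hDd A hAS))
        have h1 := Prop8Chart.differentiableAt_coe_expCfg (P := F.P K) (𝔸 := Matrix (Fin 2) (Fin 2) ℂ) η b ((A + (0 : ℝ) • δ) - H (D (A + (0 : ℝ) • δ)))
        have hE : DifferentiableAt ℂ ((fun Z : PBond (F.P K) 0 → Matrix (Fin 2) (Fin 2) ℂ => ((Prop8Chart.expCfg η Z b : (Matrix (Fin 2) (Fin 2) ℂ)ˣ) : Matrix (Fin 2) (Fin 2) ℂ)) ∘
            (fun X : PBond (F.P K) 0 → Matrix (Fin 2) (Fin 2) ℂ => X - H (D X))) (A + (0 : ℝ) • δ) := h1.comp (A + (0 : ℝ) • δ) hΨ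
        have hcomp : DifferentiableAt ℝ (((fun Z : PBond (F.P K) 0 → Matrix (Fin 2) (Fin 2) ℂ => ((Prop8Chart.expCfg η Z b : (Matrix (Fin 2) (Fin 2) ℂ)ˣ) : Matrix (Fin 2) (Fin 2) ℂ)) ∘
            (fun X : PBond (F.P K) 0 → Matrix (Fin 2) (Fin 2) ℂ => X - H (D X))) ∘ (fun t : ℝ => A + t • δ)) 0 :=
          (hE.restrictScalars ℝ).comp (0 : ℝ) hline
        exact hcomp
      · have hΦb : (fun t : ℝ => ((Φloc (A + t • δ) b : Matrix.specialUnitaryGroup (Fin 2) ℂ) : Matrix (Fin 2) (Fin 2) ℂ)) =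
            fun _ : ℝ => ((GaugeField.gaugeAct uS Umin b : Matrix.specialUnitaryGroup (Fin 2) ℂ) : Matrix (Fin 2) (Fin 2) ℂ) := by
          funext t; rw [hΦloc, if_neg hNb]
        rw [hΦb]
        exact differentiableAt_const _
    have hW0 : (fun t : ℝ => Φloc (A + t • δ)) 0 = GaugeField.gaugeAct uS Umin := by
      show Φloc (A + (0 : ℝ) • δ) = _
      rw [zero_smul, add_zero, hΦA]
    have hfib' : ∀ t : ℝ, |t| < r → GaugeField.gaugeAct (h t) ((fun t : ℝ => Φloc (A + t • δ)) t) ∈ fibre F ℰp n K hnK V := fun t ht => by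
      show GaugeField.gaugeAct (h t) (Φloc (A + t • δ)) ∈ _
      rw [hΦfun]; exact hfib t ht
    exact HalvingCompetitorMapFibreStat.deriv_wilsonAction_line_eq_zero_of_stat hnK V hUfib hstat (fun t : ℝ => Φloc (A + t • δ)) uS hW0 hWd hr h hfib' hhd
  -- the chart on the sides of the `Tch`-plaquettes
  have hexp : ∀ X ∈ T, ∀ p : Plaq (F.P K) 0, Tch p →
      ((Φloc X ⟨p.src, p.μ⟩ : Matrix.specialUnitaryGroup (Fin 2) ℂ) : Matrix (Fin 2) (Fin 2) ℂ) = exp ((Complex.I * (η : ℂ)) • (X - H (D X)) ⟨p.src, p.μ⟩) ∧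
      ((Φloc X ⟨p.src.shift p.μ, p.ν⟩ : Matrix.specialUnitaryGroup (Fin 2) ℂ) : Matrix (Fin 2) (Fin 2) ℂ) = exp ((Complex.I * (η : ℂ)) • (X - H (D X)) ⟨p.src.shift p.μ, p.ν⟩) ∧
      ((Φloc X ⟨p.src.shift p.ν, p.μ⟩ : Matrix.specialUnitaryGroup (Fin 2) ℂ) : Matrix (Fin 2) (Fin 2) ℂ) = exp ((Complex.I * (η : ℂ)) • (X - H (D X)) ⟨p.src.shift p.ν, p.μ⟩) ∧
      ((Φloc X ⟨p.src, p.ν⟩ : Matrix.specialUnitaryGroup (Fin 2) ℂ) : Matrix (Fin 2) (Fin 2) ℂ) = exp ((Complex.I * (η : ℂ)) • (X - H (D X)) ⟨p.src, p.ν⟩) := by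
    intro X hX p hp
    obtain ⟨h1, h2, h3, h4⟩ := hTN p hp
    have hd := hdress X hX.1 hX.2.1 hX.2.2.2
    have hc : ∀ b, Near b → ((Φloc X b : Matrix.specialUnitaryGroup (Fin 2) ℂ) : Matrix (Fin 2) (Fin 2) ℂ) = exp ((Complex.I * (η : ℂ)) • (X - H (D X)) b) :=
      fun b hb => by rw [hΦloc, if_pos hb]; exact hUc _ hd.1 hd.2 b
    exact ⟨hc _ h1, hc _ h2, hc _ h3, hc _ h4⟩
  -- off the `Tch`-plaquettes the competitor and its dressed field are those of `A` (pinning + level-0 dressing)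
  have hoff : ∀ X ∈ T, ∀ p : Plaq (F.P K) 0, ¬ Tch p →
      (Φloc X ⟨p.src, p.μ⟩ = Φloc A ⟨p.src, p.μ⟩ ∧ Φloc X ⟨p.src.shift p.μ, p.ν⟩ = Φloc A ⟨p.src.shift p.μ, p.ν⟩ ∧
        Φloc X ⟨p.src.shift p.ν, p.μ⟩ = Φloc A ⟨p.src.shift p.ν, p.μ⟩ ∧ Φloc X ⟨p.src, p.ν⟩ = Φloc A ⟨p.src, p.ν⟩) ∧
      ((X - H (D X)) ⟨p.src, p.μ⟩ = (A - H (D A)) ⟨p.src, p.μ⟩ ∧ (X - H (D X)) ⟨p.src.shift p.μ, p.ν⟩ = (A - H (D A)) ⟨p.src.shift p.μ, p.ν⟩ ∧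
        (X - H (D X)) ⟨p.src.shift p.ν, p.μ⟩ = (A - H (D A)) ⟨p.src.shift p.ν, p.μ⟩ ∧ (X - H (D X)) ⟨p.src, p.ν⟩ = (A - H (D A)) ⟨p.src, p.ν⟩) := by
    intro X hX p hp
    obtain ⟨h1, h2, h3, h4⟩ := hTF p hp
    have hdX := hdress X hX.1 hX.2.1 hX.2.2.2
    have hΦb : ∀ b : PBond (F.P K) 0, Dm.LamBond 0 b → Φloc X b = Φloc A b := fun b hb => by
      rw [hΦloc, hΦloc]
      by_cases hNb : Near b
      · rw [if_pos hNb, if_pos hNb]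
        exact Subtype.ext (by rw [hUc _ hdX.1 hdX.2 b, hUc _ hdA.1 hdA.2 b, hZ X hX b hb])
      · rw [if_neg hNb, if_neg hNb]
    exact ⟨⟨hΦb _ h1, hΦb _ h2, hΦb _ h3, hΦb _ h4⟩, ⟨hZ X hX _ h1, hZ X hX _ h2, hZ X hX _ h3, hZ X hX _ h4⟩⟩
  -- FILE A twin (p06 g3): stationarity along the competitor lines replaces minimality
  exact HalvingDressedStationaritySU2.tracePairing_of_derivZero_localChart Dm η hη W₀ hSd hgrad H D E hE
    (S₀ := {Y : PBond (F.P K) 0 → Matrix (Fin 2) (Fin 2) ℂ | ∀ b, w 1 b * ‖Y b‖ < r₁}) (Bdat := fun c => bondAvgIter (c.1.1 : ℕ) A c.1.2) Tch Φloc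
    (fun X hX => (hdress X hX.1 hX.2.1 hX.2.2.2).1) hexp hoff hAsa hAtr (fun c => rfl) hAS hSopen (hDd A hAS) hderiv

end Summit.QuantumFields.YangMills.Theorems.HalvingSitePackage

end
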